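import Summits.AtomisticToContinuum.BoseEinsteinCondensation.Theorems.BECProbeMassFlowCloudMomentumAtomFixedN
import Summits.AtomisticToContinuum.BoseEinsteinCondensation.Theorems.BECProbeMassFlowCloudMomentumAtomFreeZeroMomentum
import Summits.AtomisticToContinuum.BoseEinsteinCondensation.Theorems.BECProbeMassFlowCloudMomentumAtomProjectionTransfer
import HarnessLib

/-!
# The crux `BECProbeMassFlow.CloudMomentumAtom` at fixed `N` (integrable `v`), PROVED
# (item stmt-AtomisticToContinuum-12310, line `registered`, lead c4)

Companion of `…Theorems.BECProbeMassFlowCloudMomentumAtomFixedN` (fixed-`N` endpoint fidelity, p165038).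
`stub_cloudMomentumAtom_fixedN` is the BODY OF THE CRUX with the density threshold `ρ₀` allowed to depend on
the particle number (`∀ N ≥ 1, ∃ ρ₀(N)` in place of `∃ ρ₀, ∀ ρ < ρ₀, ∀ᶠ N`), for every admissible `v` with
`∫ v < ∞`: pinned `δ`-near-minimisers on the torus of side `sideLength ρ (N + 1)` have zero-total-momentum
weight `≥ 1 − ε`. Inputs: `endpointFidelity_fixedN_density` (free Ky Fan gap `(2π/L)²` vs Born cost
`N L⁻³ ∫v`), `freeZeroMomentum_fixed` (p143762) and `stub_projectionTransfer` (p144993). Hence the crux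
differs from a theorem EXACTLY by the uniformity of `ρ₀` in `N` — the thermodynamic limit at fixed density,
where the free gap `∼ L⁻²` is `o(ρ)` and the bath must heal at the scale `ξ = (8πρa)^{-1/2}` instead.
-/

noncomputable section

namespace Summit.AtomisticToContinuum.BoseEinsteinCondensation.Cruxes.CloudMomentumAtom.Birth

open MeasureTheory Filter
open scoped ENNReal NNReal BigOperators ComplexConjugate
open Literature.MathematicalPhysics.QuantumManyBody.BoseGas

variable {N : ℕ} {L : ℝ}

/-! ### The crux at fixed `N` -/

/-- **`CloudMomentumAtom` at fixed `N` (integrable `v`), PROVED.** The crux's body with the density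
threshold allowed to depend on the particle number: for every repulsive finite-range `v` with `∫ v < ∞`,
every `ε > 0` and every `N ≥ 1` there is `ρ₀(v, ε, N) > 0` such that for `0 < ρ < ρ₀` there is `δ > 0` with:
every `δ`-near-minimiser `Φ` of the pinned-scatterer energy on the torus of side `L = sideLength ρ (N + 1)`
has zero-total-momentum weight `w₀(Φ) = L⁻⁶ ∫_{cell^N} |∫_{cell} Φ(X + t𝟙) dt|² dX ≥ 1 − ε`. Proof:
fixed-`N` endpoint fidelity with `ε/2` (`endpointFidelity_fixedN_density`), zero-momentum rigidity of
free near-minimisers at fixed `(N, L)` with `ε²/16` (`freeZeroMomentum_fixed`, p143762), and the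
projection transfer `w₀(Φ) ≥ (|⟨Ψ,Φ⟩| − (1 − w₀(Ψ))^{1/2})₊²` (`stub_projectionTransfer`, p144993).
So the crux `CloudMomentumAtom` (`∃ ρ₀ ∀ ρ < ρ₀ ∀ᶠ N`) differs from a theorem exactly by the
uniformity of `ρ₀` in `N`. [folklore] -/
theorem stub_cloudMomentumAtom_fixedN :
    ∀ (v : ℝ → ℝ≥0∞), IsRepulsiveFiniteRange v → (∫⁻ x : Space, v ‖x‖) ≠ ⊤ → ∀ ε : ℝ, 0 < ε →
      ∀ N : ℕ, 0 < N → ∃ ρ₀ : ℝ, 0 < ρ₀ ∧ ∀ ρ : ℝ, 0 < ρ → ρ < ρ₀ →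
        ∃ δ : ℝ≥0∞, 0 < δ ∧
          ∀ Φ : PeriodicTrialState N (sideLength ρ (N + 1)),
            impurityPeriodicEnergy v 0 Φ ≤
                impurityPeriodicGroundStateEnergy v N (sideLength ρ (N + 1)) 0 + δ →
              ENNReal.ofReal ((1 - ε) * sideLength ρ (N + 1) ^ 6) ≤
                ∫⁻ X in cellN N (sideLength ρ (N + 1)),
                  (‖∫ t in cell (sideLength ρ (N + 1)), Φ.ψ (X + fun _ => t)‖₊ : ℝ≥0∞) ^ 2 := by
  intro v hv hint ε hε N hN
  obtain ⟨ρ₀, hρ₀, H⟩ := endpointFidelity_fixedN_density v hv hint (ε / 2) (half_pos hε) N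
  refine ⟨ρ₀, hρ₀, fun ρ hρ hρlt => ?_⟩
  set L : ℝ := sideLength ρ (N + 1) with hLdef
  have hL : 0 < L := by
    rw [hLdef]; unfold sideLength
    exact Real.rpow_pos_of_pos (div_pos (by exact_mod_cast Nat.succ_pos N) hρ) _
  -- the free infimum is finite (constant trial state; cf. `periodicGroundStateEnergy_integrable_ne_top`)
  have hE : periodicGroundStateEnergy v N L ≠ ⊤ := by
    have h2 := two_mul_periodicGroundStateEnergy_le_sq hL hv.1 N
    have hfin : ((N : ℝ≥0∞) ^ 2) * ((ENNReal.ofReal L ^ 3)⁻¹ * ∫⁻ x : Space, v ‖x‖) ≠ ⊤ := by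
      refine ENNReal.mul_ne_top (ENNReal.pow_ne_top ENNReal.coe_ne_top) (ENNReal.mul_ne_top ?_ hint)
      exact ENNReal.inv_ne_top.2 (pow_ne_zero _ (ENNReal.ofReal_pos.2 hL).ne')
    have h1 : periodicGroundStateEnergy v N L ≤ 2 * periodicGroundStateEnergy v N L := by
      calc periodicGroundStateEnergy v N L = 1 * periodicGroundStateEnergy v N L := (one_mul _).symm
        _ ≤ 2 * periodicGroundStateEnergy v N L := mul_le_mul' (by norm_num) le_rfl
    exact ne_top_of_le_ne_top hfin (h1.trans h2)
  obtain ⟨δE, hδE, KE⟩ := H ρ hρ hρlt L rfl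
  obtain ⟨δZ, hδZ, KZ⟩ := freeZeroMomentum_fixed hN hL hv.1 hE (ε := ε ^ 2 / 16) (by positivity)
  refine ⟨min δE δZ, lt_min hδE hδZ, fun Φ hΦ => ?_⟩
  -- a free `min δE δZ`-near-minimiser
  have hlt : periodicGroundStateEnergy v N L < periodicGroundStateEnergy v N L + min δE δZ :=
    ENNReal.lt_add_right hE (lt_min hδE hδZ).ne'
  obtain ⟨Ψ, hΨ⟩ := iInf_lt_iff.1 hlt
  have hover := KE Φ Ψ (hΦ.trans (add_le_add le_rfl (min_le_left _ _)))
    (hΨ.le.trans (add_le_add le_rfl (min_le_left _ _)))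
  have hw := KZ Ψ (hΨ.le.trans (add_le_add le_rfl (min_le_right _ _)))
  exact stub_projectionTransfer N L hL ε hε Φ Ψ hover hw


end Summit.AtomisticToContinuum.BoseEinsteinCondensation.Cruxes.CloudMomentumAtom.Birth

end
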